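import Literature.MathematicalPhysics.QuantumLattice.ClusterProductStateEnergy
import Literature.MathematicalPhysics.QuantumLattice.HubbardNNRepulsionInteraction
import HarnessLib

/-!
# Cluster product states with NON-VANISHING straddling terms: the cluster variational principle with an explicit straddle correction, and
# the density–density straddlers of the nearest-neighbour repulsion `V` (they factorise into block densities)

Topic `Literature/MathematicalPhysics/QuantumLattice` (family `hubbard`; general `d`). Companion of `ClusterProductStateEnergy.lean` (the infinite-volume
cluster variational principle `tiGroundEnergyDensityAt_le_of_rectTilingState` for interactions whose terms STRADDLING the cell boundary have zero
expectation in the rectangular product state `⊗_v ρ₀` — every one-band HOPPING model). For the extended `t–t'–U–V` model of the material-oracle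
boxes (`hubbardTT'VFermionInteraction`, Schüler et al. 2013 eq. (1); the NdNiO₂ object-M box carries `V/t ∈ [0.49, 0.67]`) the straddling
density–density terms `V n_x n_y` do NOT vanish: in a product of block states they FACTORISE, `ω(n_x n_y) = ω(n_x)·ω(n_y)` (two different blocks), so
the straddle correction is an explicit quadratic form in the SITE DENSITIES of `ρ₀` — computable from the same cluster vector, no kinematic `V·W`
allowance (`HubbardTTPrimeNNRepulsionTransport`: `+V·2(ρ + 2D)` / `+V(2ρ + ρ²)`).

* §1 GENERIC, no vanishing hypothesis: `cellAvg_meanEnergy_rectTilingState_eq_add_straddle` — `|C|⁻¹ Σ_c e_Ψ(ω ∘ τ_c) = |C|⁻¹ Re(tr(H_{cell} ρ₀) − ω(Ψ∅) + S)`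
  with the STRADDLE SUM `S = Σ_{Y ⊆ thicken_R cell, Y ⊄ cell} |Y ∩ cell|·|Y|⁻¹ ω(Ψ Y)` (`sum_siteEnergy_sub_eq` verbatim), and
  **`tiGroundEnergyDensityAt_le_of_rectTilingState_add_straddle`**: `e_{ρ̄}(Ψ,R) ≤ |C|⁻¹ Re(tr(H_{cell} ρ₀) − ω(Ψ∅) + S)`.
* §2 DENSITY STRADDLERS FACTORISE: `rectTilingState_expect_siteNumber_mul_siteNumber` — for sites `x, y` in different blocks,
  `ω((n_{x↑}+n_{x↓})(n_{y↑}+n_{y↓})) = β_x · β_y` with the block values `β`; `blockVal_siteNumber_eq_trace` — the block value of the site number at `y` in block `j`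
  is `tr(N_{y − ℓ_q(j)} ρ₀)`, the site density of `ρ₀` at the back-translated site; hence for a straddling nearest-neighbour bond
  **`rectTilingState_expect_nnRepulsion_pair_eq`**: `ω(Φ_V {x, x+e_i}) = V · tr(N_{x'} ρ₀) · tr(N_{y'} ρ₀)`, and the non-pair terms vanish.

* §3 ENUMERATION (any state): `straddleSum_nnRepulsion_eq` — the straddle sum of `Φ_V` over any region `T` reduces to the nearest-neighbour pairs of `T` with
  EXACTLY ONE endpoint in the cell, weight `1/2` each (`card_pair_inter_mul_inv_of_not_subset`); with §2 each such term is `½·V·β·β`.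

Everything is PROVED; no definition, no named fact, no number, no `sorry`. HONEST SCOPE: identities; the packaged `t–t'–U–V` cluster cap (needs the
translation covariance / finite range of `hubbardTT'VFermionInteraction`, not yet in the tree) and the closed row/column form of the boundary sum for a
given `a × b` cell are left to the consumer (one quadratic form in the site densities of the cluster vector).

## Tree / Mathlib search

REUSED: `rectTilingState(_expect_box_zero/_isPeriodic/_expect_mul_of_ne)`, `rectPartition`, `halfOpenRect`, `rectCopy`, `trace_mul_rectCopy`, `rectBackEquiv`,
`sum_cell_density_rectTilingState_eq`, `sum_cell_eq_sum_halfOpenRect` (`FermionRectTilingProductState`, `ClusterProductStateEnergy`); `sum_siteEnergy_sub_eq`,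
`siteEnergy_eq_expect_shift_meanEnergyObs` (`PeriodicInteractionsCellEnergy`); `IsPeriodic.tiGroundEnergyDensityAt_le_cellAvg`; `blockVal(_apply)`, `blockEmb`,
`mem_blockLoc`; `fermionEmbed_numberOp`, `nAt`; `nnRepulsionFermionInteraction(_apply_pair/_apply_eq_zero)` (`HubbardNNRepulsionInteraction`).

## References

* D. Ruelle, *Statistical Mechanics: Rigorous Results* (1969), §3.3. [cite: Ruelle1969, §3.3]
* M. Schüler, M. Rösner, T. O. Wehling, A. I. Lichtenstein, M. I. Katsnelson, PRL 111 (2013) 036601, eq. (1) (extended Hubbard `U–V`). [cite: SchulerEtAl2013, Eq. (1)]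
* H. Araki, H. Moriya, Rev. Math. Phys. 15 (2003) 93, §11.1 Thm. 11.2 (product states). [cite: ArakiMoriya2003, §11.1 Theorem 11.2]
-/

noncomputable section

namespace Literature.MathematicalPhysics.QuantumLattice

open Matrix Finset HubbardWave0 Literature.Probability.LatticeModels ThermodynamicLimit
open scoped ComplexOrder BigOperators

namespace InfVolFermionState

variable {d : ℕ}

section Generic

variable (q : Fin d → ℕ) (ρ₀ : FermionOp (halfOpenRect q)) (hev : parityAut ρ₀ = ρ₀) (hpsd : ρ₀.PosSemidef) (htr : ρ₀.trace = 1)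

/-- **Cell energy of the tiling state with the straddle sum explicit**: `Σ_c ε(pos c) = tr(H_{cell} ρ₀) − ω(Ψ∅) + S`,
`S = Σ_{Y ⊆ thicken_R cell, Y ⊄ cell} |Y∩cell|·|Y|⁻¹·ω(Ψ Y)`. [cite: BratteliRobinsonII1997, §6.2.4 (Prop. 6.2.39 ff.)] -/
theorem sum_cell_siteEnergy_rectTilingState_eq_add_straddle {Ψ : FermionInteraction d} {R : ℝ} (hR : Ψ.HasFiniteRange R) :
    ∑ c : Cell q, siteEnergy Ψ (rectTilingState q ρ₀ hev hpsd htr) R (cellPos c) =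
      (Ψ.localHamiltonian (halfOpenRect q) * ρ₀).trace - (rectTilingState q ρ₀ hev hpsd htr).expect ∅ (Ψ.Φ ∅) +
        ∑ Y ∈ (thicken (halfOpenRect q) R).powerset with ¬ Y ⊆ halfOpenRect q,
          ((Y ∩ halfOpenRect q).card : ℂ) * ((Y.card : ℂ)⁻¹ * (rectTilingState q ρ₀ hev hpsd htr).expect Y (Ψ.Φ Y)) := by
  rw [sum_cell_eq_sum_halfOpenRect q (fun x => siteEnergy Ψ (rectTilingState q ρ₀ hev hpsd htr) R x),
    ← rectTilingState_expect_box_zero q ρ₀ hev hpsd htr]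
  have h := InfVolFermionState.sum_siteEnergy_sub_eq (Ψ := Ψ) (ω := rectTilingState q ρ₀ hev hpsd htr) hR (halfOpenRect q)
  rw [sub_eq_iff_eq_add] at h
  rw [h]
  ring

/-- **THE CLUSTER VARIATIONAL PRINCIPLE WITH STRADDLE CORRECTION** (no vanishing hypothesis): for every translation-covariant `Ψ` of finite range `R`,
`e_{ρ̄}(Ψ, R) ≤ |C|⁻¹ · Re(tr(H_{cell} ρ₀) − ω(Ψ∅) + S)` with `ρ̄ = Re tr(N ρ₀)/|C|` and the straddle sum `S` of the tiling state.
[cite: Ruelle1969, §3.3] [cite: BratteliRobinsonII1997, Thm. 6.2.40] -/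
theorem tiGroundEnergyDensityAt_le_of_rectTilingState_add_straddle {Ψ : FermionInteraction d} {R : ℝ} (hT : Ψ.IsTranslationInvariant)
    (hR : Ψ.HasFiniteRange R) :
    Ψ.tiGroundEnergyDensityAt R ((Fintype.card (Cell q) : ℝ)⁻¹ * ((totalNumber : FermionOp (halfOpenRect q)) * ρ₀).trace.re) ≤
      (Fintype.card (Cell q) : ℝ)⁻¹ *
        ((Ψ.localHamiltonian (halfOpenRect q) * ρ₀).trace - (rectTilingState q ρ₀ hev hpsd htr).expect ∅ (Ψ.Φ ∅) +
          ∑ Y ∈ (thicken (halfOpenRect q) R).powerset with ¬ Y ⊆ halfOpenRect q,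
            ((Y ∩ halfOpenRect q).card : ℂ) * ((Y.card : ℂ)⁻¹ * (rectTilingState q ρ₀ hev hpsd htr).expect Y (Ψ.Φ Y))).re := by
  rw [← sum_cell_density_rectTilingState_eq q ρ₀ hev hpsd htr, ← sum_cell_siteEnergy_rectTilingState_eq_add_straddle q ρ₀ hev hpsd htr hR,
    Complex.re_sum]
  have hterm : ∀ c : Cell q, ((rectTilingState q ρ₀ hev hpsd htr).shift (cellPos c)).meanEnergy Ψ R =
      (siteEnergy Ψ (rectTilingState q ρ₀ hev hpsd htr) R (cellPos c)).re := fun c => by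
    rw [meanEnergy, siteEnergy_eq_expect_shift_meanEnergyObs hT]
  have h := (rectTilingState_isPeriodic q ρ₀ hev hpsd htr).tiGroundEnergyDensityAt_le_cellAvg Ψ R
  simp_rw [hterm] at h
  exact h

end Generic

/-! ### §2. Density–density straddlers factorise -/

section Density

variable (q : Fin d → ℕ) (ρ₀ : FermionOp (halfOpenRect q)) (hev : parityAut ρ₀ = ρ₀) (hpsd : ρ₀.PosSemidef) (htr : ρ₀.trace = 1)

/-- **A density–density word between two different blocks FACTORISES in the tiling state**:
`ω((n_{x↑}+n_{x↓})(n_{y↑}+n_{y↓})) = β(x)·β(y)` with the block values `β` of the two site numbers (product property of the even block states; the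
site number is an even element of its block). [cite: ArakiMoriya2003, §11.1 Theorem 11.2 eq. (11.4)] -/
theorem rectTilingState_expect_siteNumber_mul_siteNumber {x y : Site d}
    (hxy : (rectPartition d q).cls x ≠ (rectPartition d q).cls y) {Y : Finset (Site d)} (hx : x ∈ Y) (hy : y ∈ Y)
    (hYxy : ∀ z ∈ Y, z = x ∨ z = y) :
    (rectTilingState q ρ₀ hev hpsd htr).expect Y ((nAt x hx 0 + nAt x hx 1) * (nAt y hy 0 + nAt y hy 1)) =
      blockVal (rectPartition d q) (fun v => rectCopy q ρ₀ v) ((rectPartition d q).cls x)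
          ((rectPartition d q).blockLoc_subset_block Y _)
          (nAt x ((rectPartition d q).mem_blockLoc.2 ⟨hx, rfl⟩) 0 + nAt x ((rectPartition d q).mem_blockLoc.2 ⟨hx, rfl⟩) 1) *
        blockVal (rectPartition d q) (fun v => rectCopy q ρ₀ v) ((rectPartition d q).cls y)
          ((rectPartition d q).blockLoc_subset_block Y _)
          (nAt y ((rectPartition d q).mem_blockLoc.2 ⟨hy, rfl⟩) 0 + nAt y ((rectPartition d q).mem_blockLoc.2 ⟨hy, rfl⟩) 1) := by
  set P := rectPartition d q with hP
  have hx' : x ∈ P.blockLoc Y (P.cls x) := P.mem_blockLoc.2 ⟨hx, rfl⟩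
  have hy' : y ∈ P.blockLoc Y (P.cls y) := P.mem_blockLoc.2 ⟨hy, rfl⟩
  have ha : (nAt x hx 0 + nAt x hx 1 : FermionOp Y) =
      fermionEmbed (P.blockEmb Y (P.cls x)) (nAt x hx' 0 + nAt x hx' 1) := by
    rw [map_add, BlockPartition.blockEmb, nAt, nAt, nAt, nAt, fermionEmbed_numberOp, fermionEmbed_numberOp]
    rfl
  have hb : (nAt y hy 0 + nAt y hy 1 : FermionOp Y) =
      fermionEmbed (P.blockEmb Y (P.cls y)) (nAt y hy' 0 + nAt y hy' 1) := by
    rw [map_add, BlockPartition.blockEmb, nAt, nAt, nAt, nAt, fermionEmbed_numberOp, fermionEmbed_numberOp]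
    rfl
  have hΛ : ∀ k ∈ P.blockClasses Y, k = P.cls x ∨ k = P.cls y := by
    intro k hk
    obtain ⟨z, hz, rfl⟩ := Finset.mem_image.1 hk
    rcases hYxy z hz with rfl | rfl
    · exact Or.inl rfl
    · exact Or.inr rfl
  rw [ha, hb]
  exact rectTilingState_expect_mul_of_ne q ρ₀ hev hpsd htr Y hxy hΛ _ _

/-- **The block value of a site number is the site density of `ρ₀` at the back-translated site**:
`β_j(n_{y↑}+n_{y↓}) = tr((n_{y'↑}+n_{y'↓}) ρ₀)`, `y' = y − ℓ_q(j)` (for `y` in block `j`). [cite: ArakiMoriya2003, §4.1 Def. 4.3 and Def. 4.5] -/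
theorem blockVal_siteNumber_eq_trace {X : Finset (Site d)} {j : Site d} (hX : X ⊆ (rectPartition d q).block j) {y : Site d} (hy : y ∈ X) :
    blockVal (rectPartition d q) (fun v => rectCopy q ρ₀ v) j hX (nAt y hy 0 + nAt y hy 1) =
      ((nAt (y - superlatVec q j) (mem_shiftSet.1 (hX hy)) 0 + nAt (y - superlatVec q j) (mem_shiftSet.1 (hX hy)) 1 :
        FermionOp (halfOpenRect q)) * ρ₀).trace := by
  rw [blockVal_apply]
  change (_ * rectCopy q ρ₀ j).trace = _
  rw [trace_mul_rectCopy, map_add, map_add, fermionEmbed_fermionEmbed, fermionEmbed_fermionEmbed, nAt, nAt, fermionEmbed_numberOp,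
    fermionEmbed_numberOp]
  rfl

/-- **A straddling nearest-neighbour density–density term factorises into two block densities**: if `x` and `x + e_i` lie in different blocks,
`ω(Φ_V {x, x+e_i}) = V · β(x) · β(x+e_i)` with the block values of the two site numbers (each = a site density of `ρ₀` at the back-translated site,
`blockVal_siteNumber_eq_trace`). [cite: SchulerEtAl2013, Eq. (1)] [cite: ArakiMoriya2003, §11.1 Theorem 11.2] -/
theorem rectTilingState_expect_nnRepulsion_pair_eq (V : ℝ) (x : Site d) (i : Fin d)
    (hxy : (rectPartition d q).cls x ≠ (rectPartition d q).cls (x + unitVec i)) :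
    (rectTilingState q ρ₀ hev hpsd htr).expect {x, x + unitVec i} ((nnRepulsionFermionInteraction d V).Φ {x, x + unitVec i}) =
      (V : ℂ) *
        (blockVal (rectPartition d q) (fun v => rectCopy q ρ₀ v) ((rectPartition d q).cls x)
            ((rectPartition d q).blockLoc_subset_block {x, x + unitVec i} _)
            (nAt x ((rectPartition d q).mem_blockLoc.2 ⟨Finset.mem_insert_self _ _, rfl⟩) 0 +
              nAt x ((rectPartition d q).mem_blockLoc.2 ⟨Finset.mem_insert_self _ _, rfl⟩) 1) *
          blockVal (rectPartition d q) (fun v => rectCopy q ρ₀ v) ((rectPartition d q).cls (x + unitVec i))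
            ((rectPartition d q).blockLoc_subset_block {x, x + unitVec i} _)
            (nAt (x + unitVec i) ((rectPartition d q).mem_blockLoc.2 ⟨Finset.mem_insert_of_mem (Finset.mem_singleton_self _), rfl⟩) 0 +
              nAt (x + unitVec i) ((rectPartition d q).mem_blockLoc.2 ⟨Finset.mem_insert_of_mem (Finset.mem_singleton_self _), rfl⟩) 1)) := by
  have hmem : ∀ z ∈ ({x, x + unitVec i} : Finset (Site d)), z = x ∨ z = x + unitVec i := fun z hz => by
    simpa only [Finset.mem_insert, Finset.mem_singleton] using hz
  rw [nnRepulsionFermionInteraction_apply_pair, map_smul, smul_eq_mul,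
    rectTilingState_expect_siteNumber_mul_siteNumber q ρ₀ hev hpsd htr hxy _ _ hmem]

/-- **Non-pair terms of the repulsion vanish identically** (so only straddling NEAREST-NEIGHBOUR BONDS contribute to the straddle sum of `Φ_V`).
[cite: SchulerEtAl2013, Eq. (1)] -/
theorem expect_nnRepulsion_eq_zero_of_not_pair (ω : InfVolFermionState d) (V : ℝ) {Y : Finset (Site d)}
    (h : ∀ (x : Site d) (i : Fin d), Y ≠ {x, x + unitVec i}) :
    ω.expect Y ((nnRepulsionFermionInteraction d V).Φ Y) = 0 := by
  rw [nnRepulsionFermionInteraction_apply_eq_zero V h, map_zero]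

end Density

/-! ### §3. Enumeration of the straddle sum of the nearest-neighbour repulsion -/

section Enumeration

/-- The weight `|Y ∩ C|·|Y|⁻¹` of a nearest-neighbour pair `Y = {x, x+e_i}` NOT contained in `C`: it is `1/2` when exactly one endpoint lies in `C`
and `0` when none does. [cite: BratteliRobinsonII1997, §6.2.4 (Prop. 6.2.39 ff.)] -/
theorem card_pair_inter_mul_inv_of_not_subset (C : Finset (Site d)) (x : Site d) (i : Fin d)
    (h : ¬ ({x, x + unitVec i} : Finset (Site d)) ⊆ C) :
    ((({x, x + unitVec i} : Finset (Site d)) ∩ C).card : ℂ) * ((({x, x + unitVec i} : Finset (Site d)).card : ℂ)⁻¹) =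
      if (x ∈ C ∧ x + unitVec i ∉ C) ∨ (x ∉ C ∧ x + unitVec i ∈ C) then (1 / 2 : ℂ) else 0 := by
  classical
  have hne : x ≠ x + unitVec i := self_ne_add_unitVec x i
  rw [Finset.card_pair hne]
  by_cases hx : x ∈ C
  · have hy : x + unitVec i ∉ C := fun hy => h (Finset.insert_subset hx (Finset.singleton_subset_iff.2 hy))
    have hI : ({x, x + unitVec i} : Finset (Site d)) ∩ C = {x} := by
      ext z; simp only [Finset.mem_inter, Finset.mem_insert, Finset.mem_singleton]
      constructor
      · rintro ⟨hz | hz, hzC⟩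
        · exact hz
        · exact absurd (hz ▸ hzC) hy
      · rintro rfl; exact ⟨Or.inl rfl, hx⟩
    rw [hI, Finset.card_singleton, if_pos (Or.inl ⟨hx, hy⟩)]
    push_cast; norm_num
  · by_cases hy : x + unitVec i ∈ C
    · have hI : ({x, x + unitVec i} : Finset (Site d)) ∩ C = {x + unitVec i} := by
        ext z; simp only [Finset.mem_inter, Finset.mem_insert, Finset.mem_singleton]
        constructor
        · rintro ⟨hz | hz, hzC⟩
          · exact absurd (hz ▸ hzC) hx
          · exact hz
        · rintro rfl; exact ⟨Or.inr rfl, hy⟩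
      rw [hI, Finset.card_singleton, if_pos (Or.inr ⟨hx, hy⟩)]
      push_cast; norm_num
    · have hI : ({x, x + unitVec i} : Finset (Site d)) ∩ C = ∅ := by
        ext z; simp only [Finset.mem_inter, Finset.mem_insert, Finset.mem_singleton, Finset.notMem_empty, iff_false, not_and]
        rintro (rfl | rfl)
        · exact hx
        · exact hy
      rw [hI, Finset.card_empty, if_neg (fun hh => hh.elim (fun h1 => hx h1.1) (fun h2 => hy h2.2))]
      simp

/-- **ENUMERATION OF THE STRADDLE SUM OF THE NEAREST-NEIGHBOUR REPULSION**: in ANY state `ω`, the straddle sum of `Φ_V` over the region `T ⊇` cell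
reduces to the nearest-neighbour pairs of `T` with EXACTLY ONE endpoint in the cell, each with weight `1/2`:
`S_V = Σ_{x ∈ T, i : x+e_i ∈ T} [exactly one of x, x+e_i ∈ C]·½·ω(Φ_V {x, x+e_i})`. [cite: BratteliRobinsonII1997, §6.2.4 (Prop. 6.2.39 ff.)] [cite: SchulerEtAl2013, Eq. (1)] -/
theorem straddleSum_nnRepulsion_eq (ω : InfVolFermionState d) (V : ℝ) (C T : Finset (Site d)) :
    ∑ Y ∈ T.powerset with ¬ Y ⊆ C, ((Y ∩ C).card : ℂ) * ((Y.card : ℂ)⁻¹ * ω.expect Y ((nnRepulsionFermionInteraction d V).Φ Y)) =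
      ∑ p ∈ (T ×ˢ (univ : Finset (Fin d))) with p.1 + unitVec p.2 ∈ T,
        if (p.1 ∈ C ∧ p.1 + unitVec p.2 ∉ C) ∨ (p.1 ∉ C ∧ p.1 + unitVec p.2 ∈ C) then
          (1 / 2 : ℂ) * ω.expect {p.1, p.1 + unitVec p.2} ((nnRepulsionFermionInteraction d V).Φ {p.1, p.1 + unitVec p.2})
        else 0 := by
  classical
  rw [Finset.sum_filter]
  rw [sum_powerset_eq_of_hubbard_support T
    (fun Y => if ¬ Y ⊆ C then ((Y ∩ C).card : ℂ) * ((Y.card : ℂ)⁻¹ * ω.expect Y ((nnRepulsionFermionInteraction d V).Φ Y)) else 0)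
    (fun X h1 h2 => by
      by_cases hX : ¬ X ⊆ C
      · rw [if_pos hX, nnRepulsionFermionInteraction_apply_eq_zero V h2, map_zero, mul_zero, mul_zero]
      · rw [if_neg hX])]
  have h0 : ∑ x ∈ T, (if ¬ ({x} : Finset (Site d)) ⊆ C then
      ((({x} : Finset (Site d)) ∩ C).card : ℂ) * (((({x} : Finset (Site d))).card : ℂ)⁻¹ *
        ω.expect {x} ((nnRepulsionFermionInteraction d V).Φ {x})) else 0) = 0 := by
    refine Finset.sum_eq_zero fun x _ => ?_
    rw [nnRepulsionFermionInteraction_apply_singleton, map_zero, mul_zero, mul_zero, ite_self]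
  rw [h0, zero_add]
  refine Finset.sum_congr rfl fun p _ => ?_
  by_cases hsub : ({p.1, p.1 + unitVec p.2} : Finset (Site d)) ⊆ C
  · have hx : p.1 ∈ C := hsub (Finset.mem_insert_self _ _)
    have hy : p.1 + unitVec p.2 ∈ C := hsub (Finset.mem_insert_of_mem (Finset.mem_singleton_self _))
    rw [if_neg (not_not.2 hsub), if_neg (fun hh => hh.elim (fun h1 => h1.2 hy) (fun h2 => h2.1 hx))]
  · rw [if_pos hsub, ← mul_assoc, card_pair_inter_mul_inv_of_not_subset C p.1 p.2 hsub]
    split_ifs <;> simp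

end Enumeration

end InfVolFermionState

end Literature.MathematicalPhysics.QuantumLattice

end
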